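import Literature.Computability.AlgebraicComplexity.SkewAdjugateFirstOrder
import Literature.Computability.AlgebraicComplexity.GLAnnihilator
import Literature.Computability.AlgebraicComplexity.LMR13BoundaryFormHessian
import HarnessLib

/-!
# LMR13 §3.5, the stabiliser of `P_Λ`: the master identity `X·P_Λ = 0 ⟹ tr(adj A·N_s) + tr(D(A,N_a)·S) = 0`
# and its split into the three `(A,S)`-blocks (infrastructure §B of the elementary route to (X3b))

[topic Computability/AlgebraicComplexity]

Landsberg–Manivel–Ressayre 2013, §3.5 (journal p. 481; arXiv:1004.4802 `p0008.txt:L74–94`): "we compute the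
stabilizer of `P_Λ` inside `GL(M_n(ℂ))`. The easiest way to make this computation uses the decomposition
`ℂⁿ⊗ℂⁿ = Λ²ℂⁿ ⊕ S²ℂⁿ` of the space of matrices into skew-symmetric and symmetric ones." This file types the
first, elementary step of that computation for the ANNIHILATOR `glAnn (pLambda n)` (`GLAnnihilator.lean`): since
`P_Λ(A + S) = (1/n)·tr(adj(A)·S)` (`aeval_pLambda_skew_add_sym`) is LINEAR in the symmetric part, the condition
`X·P_Λ = 0`, read at the point `A + S` to first order along `L_X(A+S)` (`coeff_one_aeval_affineLine`), is the
master identity `trace_adjugate_add_trace_adjDeriv_eq_zero`, and scaling `S ↦ cS` (`c = 0, ±1`) splits it into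
the three blocks `pLambda_glAnn_blocks`:
(I) `tr(adj(A)·(L_X A)_sym) = 0`, (III) `tr(adj(A)·(L_X S)_sym) + tr(D(A,(L_X A)_skew)·S) = 0`,
(II) `tr(D(A,(L_X S)_skew)·S) = 0`, for all skew `A` and symmetric `S` — the typed form of the cell memo
`HOME/lmr/X3b-ELEMENTARY-ROUTE-t10g4.md` §2 (and of lead-lmr's BLUEPRINT-X3b §3.1), on which the test-point
arguments for `finrank glAnn (pLambda n) ≤ 2n² − 1` run. Here `(L_X M)_{kl} = Σ_p X_{p,(k,l)} M_p` and
`D(A,B) = adjDeriv A B = [t¹] adj(A + tB)` (`SkewAdjugateFirstOrder.lean`), whose linearity in `B`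
(`adjDeriv_add`, `adjDeriv_smul`, via `adjDeriv_apply_eq_sum`) is also proved here.

Everything is PROVED; theorems only; no named fact. Honest framing: `LMR2013_prop_3_5_1` remains OPEN in the tree
(it is reduced to (X3b) by `LMR2013_prop_3_5_1_of_finrank_glAnn_le`); VP ≠ VNP is NOT proved and nothing here is
progress on it.

## References

* [LandsbergManivelRessayre2013] J. M. Landsberg, L. Manivel, N. Ressayre, *Hypersurfaces with degenerate duals and
  the geometric complexity theory program*, Comment. Math. Helv. 88 (2013) 469–484, §3.5 (p. 481).
-/

noncomputable section

open Matrix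

namespace Literature.Computability.AlgebraicComplexity

namespace SkewAdj

universe v

section Linear

variable {ι : Type v} [Fintype ι] [DecidableEq ι]

/-- `D(A,B)` as a first-order Taylor coefficient: `D(A,B)_{ij} = Σ_q B_q · (∂_q adj_{ij})(A)` for the adjugate of
the generic matrix. [cite: LandsbergManivelRessayre2013, §3.5 (p. 481)] -/
theorem adjDeriv_apply_eq_sum (A B : Matrix ι ι ℂ) (i j : ι) :
    adjDeriv A B i j = ∑ q : ι × ι, B q.1 q.2 *
      MvPolynomial.eval (fun q : ι × ι => A q.1 q.2)
        (MvPolynomial.pderiv q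
          ((Matrix.of fun a b => (MvPolynomial.X (a, b) : MvPolynomial (ι × ι) ℂ)).adjugate i j)) := by
  rw [adjDeriv_apply, ← coeff_one_aeval_affineLine (fun q : ι × ι => A q.1 q.2) (fun q : ι × ι => B q.1 q.2)]
  congr 2
  set φ := MvPolynomial.aeval (R := ℂ)
    (fun q : ι × ι => Polynomial.C (A q.1 q.2) + Polynomial.C (B q.1 q.2) * Polynomial.X) with hφ
  have hline : lineMat A B =
      φ.toRingHom.mapMatrix (Matrix.of fun a b => (MvPolynomial.X (a, b) : MvPolynomial (ι × ι) ℂ)) := by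
    ext a b
    rw [lineMat_apply, RingHom.mapMatrix_apply, Matrix.map_apply, Matrix.of_apply, AlgHom.toRingHom_eq_coe,
      RingHom.coe_coe, MvPolynomial.aeval_X, mul_comm]
  rw [hline, ← RingHom.map_adjugate, RingHom.mapMatrix_apply, Matrix.map_apply]
  rfl

/-- `D(A,·)` is additive. [cite: LandsbergManivelRessayre2013, §3.5 (p. 481)] -/
theorem adjDeriv_add (A B B' : Matrix ι ι ℂ) : adjDeriv A (B + B') = adjDeriv A B + adjDeriv A B' := by
  ext i j
  simp only [adjDeriv_apply_eq_sum, Matrix.add_apply, add_mul, Finset.sum_add_distrib]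

/-- `D(A,·)` is homogeneous. [cite: LandsbergManivelRessayre2013, §3.5 (p. 481)] -/
theorem adjDeriv_smul (A B : Matrix ι ι ℂ) (c : ℂ) : adjDeriv A (c • B) = c • adjDeriv A B := by
  ext i j
  simp only [adjDeriv_apply_eq_sum, Matrix.smul_apply, smul_eq_mul, mul_assoc, Finset.mul_sum]

/-- `D(A,0) = 0`. [cite: LandsbergManivelRessayre2013, §3.5 (p. 481)] -/
theorem adjDeriv_zero (A : Matrix ι ι ℂ) : adjDeriv A 0 = 0 := by
  ext i j
  simp only [adjDeriv_apply_eq_sum, Matrix.zero_apply, zero_mul, Finset.sum_const_zero]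

/-- `[t¹] tr(adj(A+tB)·(S + tN)) = tr(D(A,B)·S) + tr(adj(A)·N)`. [cite: LandsbergManivelRessayre2013, §3.5 (p. 481)] -/
theorem coeff_one_trace_adjugate_lineMat_mul (A B S N : Matrix ι ι ℂ) :
    (Matrix.trace ((lineMat A B).adjugate * lineMat S N)).coeff 1 =
      Matrix.trace (adjDeriv A B * S) + Matrix.trace (A.adjugate * N) := by
  simp only [Matrix.trace, Matrix.diag, Matrix.mul_apply, Polynomial.finsetSum_coeff, lineMat_apply,
    coeff_one_mul_C_add_X_mul_C, coeff_zero_adjugate_lineMat, adjDeriv_apply, Finset.sum_add_distrib]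

end Linear

/-! ### The master identity for `X ∈ 𝔤𝔩(W)_{P_Λ}` and the three blocks -/

section Master

/-- Pointwise first-order form of the action: `(X·P)(M) = [t¹] P(M + t·L_X M)` with `(L_X M)_b = Σ_a X_{ab} M_a`.
[cite: LandsbergManivelRessayre2013, §3.5 (p. 481)] -/
theorem eval_glTangentMap_eq_coeff_one {σ : Type v} [Fintype σ] (P : MvPolynomial σ ℂ)
    (X : Matrix σ σ ℂ) (M : σ → ℂ) :
    MvPolynomial.eval M (glTangentMap P X) =
      (MvPolynomial.aeval (fun b : σ => Polynomial.C (M b) + Polynomial.C (∑ a, X a b * M a) * Polynomial.X)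
        P).coeff 1 := by
  classical
  rw [coeff_one_aeval_affineLine, glTangentMap_apply, map_sum]
  simp_rw [map_sum, MvPolynomial.smul_eval, map_mul, MvPolynomial.eval_X]
  rw [Finset.sum_comm]
  refine Finset.sum_congr rfl fun b _ => ?_
  rw [Finset.sum_mul]
  refine Finset.sum_congr rfl fun a _ => ?_
  ring

variable {n : ℕ}

/-- **Master identity of the elementary route.** For `X ∈ 𝔤𝔩(W)_{P_Λ}`, every skew `A` and symmetric `S`, with
`N := L_X(A + S)` (`(L_X M)_{kl} = Σ_p X_{p,(k,l)} M_p`), `N_s, N_a` its symmetric and skew parts: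
`tr(adj(A)·N_s) + tr(D(A,N_a)·S) = 0` — the `t¹`-coefficient of `P_Λ((A + tN_a) + (S + tN_s)) =
(1/n)·tr(adj(A+tN_a)·(S+tN_s))` (`aeval_pLambda_skew_add_sym` over `ℂ[t]`).
[cite: LandsbergManivelRessayre2013, §3.5 (p. 481)] -/
theorem trace_adjugate_add_trace_adjDeriv_eq_zero (hn : n ≠ 0)
    {X : Matrix (Fin n × Fin n) (Fin n × Fin n) ℂ} (hX : X ∈ glAnn (pLambda n))
    {A S : Matrix (Fin n) (Fin n) ℂ} (hA : Aᵀ = -A) (hS : Sᵀ = S) :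
    Matrix.trace (A.adjugate * ((1 / 2 : ℂ) •
        ((Matrix.of fun k l => ∑ p : Fin n × Fin n, X p (k, l) * (A + S) p.1 p.2) +
          (Matrix.of fun k l => ∑ p : Fin n × Fin n, X p (k, l) * (A + S) p.1 p.2)ᵀ))) +
      Matrix.trace (adjDeriv A ((1 / 2 : ℂ) •
        ((Matrix.of fun k l => ∑ p : Fin n × Fin n, X p (k, l) * (A + S) p.1 p.2) -
          (Matrix.of fun k l => ∑ p : Fin n × Fin n, X p (k, l) * (A + S) p.1 p.2)ᵀ)) * S) = 0 := by
  set N : Matrix (Fin n) (Fin n) ℂ := Matrix.of fun k l => ∑ p : Fin n × Fin n, X p (k, l) * (A + S) p.1 p.2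
    with hN
  set Ns : Matrix (Fin n) (Fin n) ℂ := (1 / 2 : ℂ) • (N + Nᵀ) with hNs
  set Na : Matrix (Fin n) (Fin n) ℂ := (1 / 2 : ℂ) • (N - Nᵀ) with hNa
  have hNa' : Naᵀ = -Na := by
    rw [hNa, Matrix.transpose_smul, Matrix.transpose_sub, Matrix.transpose_transpose, ← smul_neg, neg_sub]
  have hNs' : Nsᵀ = Ns := by
    rw [hNs, Matrix.transpose_smul, Matrix.transpose_add, Matrix.transpose_transpose, add_comm]
  have hsum : ∀ k l, Na k l + Ns k l = N k l := fun k l => by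
    simp only [hNa, hNs, Matrix.smul_apply, Matrix.sub_apply, Matrix.add_apply, Matrix.transpose_apply,
      smul_eq_mul]
    ring
  -- the action vanishes at the point `A + S`
  have h0 : MvPolynomial.eval (fun q : Fin n × Fin n => (A + S) q.1 q.2) (glTangentMap (pLambda n) X) = 0 := by
    rw [(mem_glAnn_iff_glTangentMap_eq_zero _ _).1 hX, map_zero]
  rw [eval_glTangentMap_eq_coeff_one] at h0
  -- the line point is `(A + tN_a) + (S + tN_s)`
  have hpt : (fun b : Fin n × Fin n => Polynomial.C ((A + S) b.1 b.2) +
      Polynomial.C (∑ a : Fin n × Fin n, X a b * (A + S) a.1 a.2) * Polynomial.X) =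
      fun b : Fin n × Fin n => (lineMat A Na + lineMat S Ns) b.1 b.2 := by
    funext b
    have hb : (∑ a : Fin n × Fin n, X a b * (A + S) a.1 a.2) = N b.1 b.2 := by
      rw [hN, Matrix.of_apply]
    rw [hb, Matrix.add_apply, Matrix.add_apply, lineMat_apply, lineMat_apply, ← hsum b.1 b.2, map_add, map_add]
    ring
  have hAt : (lineMat A Na)ᵀ = -lineMat A Na := lineMat_transpose_of_skew hA hNa'
  have hSt : (lineMat S Ns)ᵀ = lineMat S Ns := by rw [lineMat_transpose, hS, hNs']
  rw [hpt, aeval_pLambda_skew_add_sym hAt hSt, Polynomial.coeff_smul, coeff_one_trace_adjugate_lineMat_mul,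
    smul_eq_mul, mul_eq_zero] at h0
  rcases h0 with h0 | h0
  · exfalso
    rw [one_div, inv_eq_zero, Nat.cast_eq_zero] at h0
    exact hn h0
  · rw [add_comm] at h0
    exact h0

/-- Expanding `L_X(A + c·S)`. [cite: LandsbergManivelRessayre2013, §3.5 (p. 481)] -/
theorem linAct_add_smul (X : Matrix (Fin n × Fin n) (Fin n × Fin n) ℂ) (A S : Matrix (Fin n) (Fin n) ℂ) (c : ℂ) :
    (Matrix.of fun k l => ∑ p : Fin n × Fin n, X p (k, l) * (A + c • S) p.1 p.2) =
      (Matrix.of fun k l => ∑ p : Fin n × Fin n, X p (k, l) * A p.1 p.2) +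
        c • (Matrix.of fun k l => ∑ p : Fin n × Fin n, X p (k, l) * S p.1 p.2) := by
  ext k l
  simp only [Matrix.of_apply, Matrix.add_apply, Matrix.smul_apply, smul_eq_mul, mul_add, Finset.sum_add_distrib,
    Finset.mul_sum]
  congr 1
  exact Finset.sum_congr rfl fun p _ => by ring

/-- **The `(A,S)`-split of the master identity into the three blocks** (S-degrees 0, 1, 2 of `X·P_Λ`; obtained
from the master identity at `S`, `0`, `−S`): with `L_A := L_X A`, `L_S := L_X S`,
(I) `tr(adj(A)·(L_A)_sym) = 0`, (III) `tr(adj(A)·(L_S)_sym) + tr(D(A,(L_A)_skew)·S) = 0`,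
(II) `tr(D(A,(L_S)_skew)·S) = 0`. [cite: LandsbergManivelRessayre2013, §3.5 (p. 481)] -/
theorem pLambda_glAnn_blocks (hn : n ≠ 0)
    {X : Matrix (Fin n × Fin n) (Fin n × Fin n) ℂ} (hX : X ∈ glAnn (pLambda n))
    {A S : Matrix (Fin n) (Fin n) ℂ} (hA : Aᵀ = -A) (hS : Sᵀ = S) :
    Matrix.trace (A.adjugate * ((1 / 2 : ℂ) •
        ((Matrix.of fun k l => ∑ p : Fin n × Fin n, X p (k, l) * A p.1 p.2) +
          (Matrix.of fun k l => ∑ p : Fin n × Fin n, X p (k, l) * A p.1 p.2)ᵀ))) = 0 ∧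
    Matrix.trace (A.adjugate * ((1 / 2 : ℂ) •
        ((Matrix.of fun k l => ∑ p : Fin n × Fin n, X p (k, l) * S p.1 p.2) +
          (Matrix.of fun k l => ∑ p : Fin n × Fin n, X p (k, l) * S p.1 p.2)ᵀ))) +
      Matrix.trace (adjDeriv A ((1 / 2 : ℂ) •
        ((Matrix.of fun k l => ∑ p : Fin n × Fin n, X p (k, l) * A p.1 p.2) -
          (Matrix.of fun k l => ∑ p : Fin n × Fin n, X p (k, l) * A p.1 p.2)ᵀ)) * S) = 0 ∧
    Matrix.trace (adjDeriv A ((1 / 2 : ℂ) •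
        ((Matrix.of fun k l => ∑ p : Fin n × Fin n, X p (k, l) * S p.1 p.2) -
          (Matrix.of fun k l => ∑ p : Fin n × Fin n, X p (k, l) * S p.1 p.2)ᵀ)) * S) = 0 := by
  set LA : Matrix (Fin n) (Fin n) ℂ := Matrix.of fun k l => ∑ p : Fin n × Fin n, X p (k, l) * A p.1 p.2 with hLA
  set LS : Matrix (Fin n) (Fin n) ℂ := Matrix.of fun k l => ∑ p : Fin n × Fin n, X p (k, l) * S p.1 p.2 with hLS
  set e₀ := Matrix.trace (A.adjugate * ((1 / 2 : ℂ) • (LA + LAᵀ))) with he₀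
  set e₁ := Matrix.trace (A.adjugate * ((1 / 2 : ℂ) • (LS + LSᵀ))) +
    Matrix.trace (adjDeriv A ((1 / 2 : ℂ) • (LA - LAᵀ)) * S) with he₁
  set e₂ := Matrix.trace (adjDeriv A ((1 / 2 : ℂ) • (LS - LSᵀ)) * S) with he₂
  have key : ∀ c : ℂ, e₀ + c * e₁ + c ^ 2 * e₂ = 0 := by
    intro c
    have hcS : (c • S)ᵀ = c • S := by rw [Matrix.transpose_smul, hS]
    have h := trace_adjugate_add_trace_adjDeriv_eq_zero hn hX hA hcS
    rw [linAct_add_smul, ← hLA, ← hLS] at h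
    have h1 : (1 / 2 : ℂ) • (LA + c • LS + (LA + c • LS)ᵀ) =
        (1 / 2 : ℂ) • (LA + LAᵀ) + c • ((1 / 2 : ℂ) • (LS + LSᵀ)) := by
      rw [Matrix.transpose_add, Matrix.transpose_smul]
      ext k l
      simp only [Matrix.smul_apply, Matrix.add_apply, Matrix.transpose_apply, smul_eq_mul]
      ring
    have h2 : (1 / 2 : ℂ) • (LA + c • LS - (LA + c • LS)ᵀ) =
        (1 / 2 : ℂ) • (LA - LAᵀ) + c • ((1 / 2 : ℂ) • (LS - LSᵀ)) := by
      rw [Matrix.transpose_add, Matrix.transpose_smul]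
      ext k l
      simp only [Matrix.smul_apply, Matrix.add_apply, Matrix.sub_apply, Matrix.transpose_apply, smul_eq_mul]
      ring
    have hD : adjDeriv A ((1 / 2 : ℂ) • (LA - LAᵀ) + c • ((1 / 2 : ℂ) • (LS - LSᵀ))) =
        adjDeriv A ((1 / 2 : ℂ) • (LA - LAᵀ)) + c • adjDeriv A ((1 / 2 : ℂ) • (LS - LSᵀ)) := by
      rw [adjDeriv_add, adjDeriv_smul A ((1 / 2 : ℂ) • (LS - LSᵀ)) c]
    have hT1 : Matrix.trace (A.adjugate * ((1 / 2 : ℂ) • (LA + LAᵀ) + c • ((1 / 2 : ℂ) • (LS + LSᵀ)))) =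
        Matrix.trace (A.adjugate * ((1 / 2 : ℂ) • (LA + LAᵀ))) +
          c * Matrix.trace (A.adjugate * ((1 / 2 : ℂ) • (LS + LSᵀ))) := by
      rw [Matrix.mul_add, Matrix.trace_add, Matrix.mul_smul A.adjugate c, Matrix.trace_smul c, smul_eq_mul]
    have hT2 : Matrix.trace ((adjDeriv A ((1 / 2 : ℂ) • (LA - LAᵀ)) +
        c • adjDeriv A ((1 / 2 : ℂ) • (LS - LSᵀ))) * (c • S)) =
        c * Matrix.trace (adjDeriv A ((1 / 2 : ℂ) • (LA - LAᵀ)) * S) +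
          c ^ 2 * Matrix.trace (adjDeriv A ((1 / 2 : ℂ) • (LS - LSᵀ)) * S) := by
      rw [Matrix.mul_smul _ c S, Matrix.trace_smul c, Matrix.add_mul, Matrix.trace_add,
        Matrix.smul_mul c _ S, Matrix.trace_smul c, smul_eq_mul, smul_eq_mul]
      ring
    rw [h1, h2, hD, hT1, hT2] at h
    rw [he₀, he₁, he₂]
    linear_combination h
  have k0 := key 0
  have k1 := key 1
  have k2 := key (-1)
  refine ⟨by linear_combination k0, ?_, ?_⟩
  · linear_combination (k1 - k2) / 2
  · linear_combination (k1 + k2) / 2 - k0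

end Master

end SkewAdj

end Literature.Computability.AlgebraicComplexity

end
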